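import Literature.IUT.HodgeTheaters.GoodLocalFrobenioidOfGaloisSlim
import Literature.IUT.HodgeTheaters.GaloisValDatumOfComplete
import Literature.IUT.HodgeTheaters.InitialThetaDataGoodLocalFrobenioid
import Literature.AnabelianGeometry.AbsoluteAnabelian.MLFSlimKummerProofs
import HarnessLib

/-!
# [IUTchI] Example 3.3 (iii) (b) UNCONDITIONAL at every actual good nonarchimedean place `K_v`
# (and (b) ∧ (c) hypothesis-free at the named witnesses `ofPlaceGalois`)

S. Mochizuki, *Inter-universal Teichmüller theory I*, kurims manuscript (May 2020), Example 3.3 (iii) p. 79: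
"(b) the category `𝒟⊢_v` (respectively, `𝒟^Θ_v`) may be reconstructed category-theoretically from `𝒞⊢_v`
(respectively, `𝒞^Θ_v`) [cf. [FrdI], Theorem 3.4, (v); [FrdII], Theorem 1.2, (i); [FrdII], Example 1.3, (i);
[AbsAnab], Theorem 1.1.1, (ii)]; (c) the category `𝒟_v` may be reconstructed category-theoretically from `ℱ̲_v`
[cf. [FrdI], Theorem 3.4, (v); [FrdII], Theorem 1.2, (i); [FrdII], Example 1.3, (i); [AbsAnab], Lemma 1.3.1]"
[claim: Mochizuki2012, status: disputed] (D-0012 claim key, series status DISPUTED — this file is a PROOF-ONLY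
composition of landed theorems of the cell; nothing of the series is asserted and no side is taken on
[IUTchIII] Cor. 3.12).  DAG node `IUTchI:Ex3.3(iii)`; row E33iii/b (and the degenerate half of E33iii/c) of
`plan/L5/SUBDAG-IUTchI-Ex33-Ex34.md`.

ALL FOUR PRINTED INPUTS OF (b) ARE KERNEL THEOREMS OF THE TREE: [FrdI] Thm. 3.4 (v) over FSM bases
(`FrdI.Thm34Sub.thm34v_FSM_holds`, layer L1), [FrdII] Thm. 1.2 (i) (`PadicFrd.Datum.thm12_*`, L1), [FrdII] Ex. 1.3 (i)
(`CosetCat.isOfFSMType`, L1/L5) — composed by abc-iut-w4-d047 into `GoodLocalFrobenioid.basesFromC_ofGalois` — and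
[AbsAnab] Thm. 1.1.1 (ii), local half: "`G_v` is slim" (`Literature.AnabelianGeometry.AbsoluteAnabelian.galoisMLF_slim_holds`,
layer L4, for EVERY finite extension of `ℚ_p`), transported to the coset category by abc-iut-L1-t4's
`PadicFrd.isSlim_cosetCat_of_isSlimGroup` (`GoodLocalFrobenioidOfGaloisSlim.lean`: `basesFromC_ofGalois_of_isSlimGroup`).
Hence clause (b) holds with NO hypothesis at abc-iut-L5-t2's instance `ofGalois` over
* `GaloisValDatum.ofComplete p k` — ANY field `k` complete for a nonarchimedean norm and finite over `ℚ_p`, `Ω := k̄`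
  (`basesFromC_ofGalois_ofComplete`), and in particular
* `GaloisValDatum.ofPlace F p v hv` — `k := F_v`, the completion of a number field `F` at a finite place `v ∣ p`
  (abc-iut-S7's `RescaledCompletion`), i.e. the `K_v`, `v ∈ V̲^good ∩ V̲^non`, of an initial Θ-datum ([IUTchI] Def. 3.1
  (e)), for EVERY covering group `Π_v ↠ G_v` (`basesFromC_ofGalois_ofPlace`);
* **the initial Θ-datum's own local data** (abc-iut-L5-t2's `InitialThetaData.goodLocalFrobenioidOfEmb` /
  `goodLocalFrobenioid` / `goodLocalFrobenioidAt`: `𝒟_v̲ = 𝓑(Π_{X̲→_v̲})⁰ ⊇ 𝒟⊢_v̲ = 𝓑(G_v̲)⁰` for `D : InitialThetaData`,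
  [IUTchI] Def. 3.1 (e)(f)) — `InitialThetaData.basesFromC_goodLocalFrobenioidOfEmb` / `_goodLocalFrobenioid` /
  `_goodLocalFrobenioidAt`: clause (b) AT THE PRINTED OBJECT with no hypothesis beyond the datum's own openness input
  `hX` of Def. 3.1 (f);
and (b) ∧ (c) hold hypothesis-free at the named witness `GoodLocalFrobenioid.ofPlaceGalois F p v hv` (`Π_v := G_v`,
a labelled degenerate choice for (c); print's `Π_v` is the arithmetic fundamental group of `X̲→_v`, for which (c) stays
conditional on [AbsAnab] Lem. 1.3.1 BY NAME via `dFromF_ofGalois_of_isSlimGroup`).  No new definition.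
-/

universe u v

namespace Literature.IUT.HodgeTheaters

open CategoryTheory Literature.AnabelianGeometry.SemiGraphs Literature.AlgebraicGeometry.Frobenioids
open Literature.AlgebraicGeometry.Frobenioids.PadicFrd Literature.AnabelianGeometry.AbsoluteAnabelian

namespace GoodLocalFrobenioid

/-! ### Any complete nonarchimedean `k` finite over `ℚ_p` -/

section Complete

variable (p : ℕ) [Fact p.Prime] (k : Type) [NontriviallyNormedField k] [CompleteSpace k] [IsUltrametricDist k]
  [NormedAlgebra ℚ_[p] k] [FiniteDimensional ℚ_[p] k]
  {P : Type} [Group P] [TopologicalSpace P]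
  (aug : P →* (GaloisValDatum.ofComplete p k).Gal) (hc : Continuous aug) (hs : Function.Surjective aug)
  (ho : IsOpenMap aug) (Kv : Type) [Field Kv] [ValuativeRel Kv] (hp : ((p : Kv)) ∈ PadicFrd.intNonzero Kv)

/-- **[AbsAnab] Thm. 1.1.1 (ii), local half, at the datum `ofComplete`**: `G_v = Gal(k̄/k)` is slim — the tree's
theorem `galoisMLF_slim_holds` (abc-iut-L4) read on `(GaloisValDatum.ofComplete p k).Gal = k̄ ≃ₐ[k] k̄`.
([IUTchI] Ex 3.3 (iii) p.79) [claim: Mochizuki2012, status: disputed] -/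
theorem isSlimGroup_gal_ofComplete : IsSlimGroup (GaloisValDatum.ofComplete p k).Gal :=
  galoisMLF_slim_holds p k

/-- **[IUTchI] Ex. 3.3 (iii) (b) UNCONDITIONAL over `K_v := k`**, any field complete for a nonarchimedean norm and
finite over `ℚ_p`, `Ω := k̄`, for EVERY `Π_v ↠ G_v`: `𝒟⊢_v = 𝓑(G_v)⁰` (resp. `𝒟^Θ_v`) is reconstructible from
`𝒞⊢_v` (resp. `𝒞^Θ_v`) at `ofGalois` — all four printed inputs ([FrdI] Thm 3.4 (v), [FrdII] Thm 1.2 (i), Ex 1.3 (i),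
[AbsAnab] Thm 1.1.1 (ii)) being kernel theorems. ([IUTchI] Ex 3.3 (iii) p.79) [claim: Mochizuki2012, status: disputed] -/
theorem basesFromC_ofGalois_ofComplete :
    (ofGalois (GaloisValDatum.ofComplete p k) aug hc hs ho Kv hp).BasesFromC :=
  basesFromC_ofGalois_of_isSlimGroup (GaloisValDatum.ofComplete p k) aug hc hs ho Kv hp
    (isSlimGroup_gal_ofComplete p k)

end Complete

/-! ### The completion `K_v = F_v` of a number field at a finite place `v ∣ p` -/

section Place

open Literature.NumberTheory.NumberFields IsDedekindDomain NumberField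

variable (F : Type) [Field F] [NumberField F] (p : ℕ) [Fact p.Prime] (v : HeightOneSpectrum (𝓞 F))
  (hv : ((p : ℕ) : 𝓞 F) ∈ v.asIdeal)
  {P : Type} [Group P] [TopologicalSpace P]
  (aug : P →* (GaloisValDatum.ofPlace F p v hv).Gal) (hc : Continuous aug) (hs : Function.Surjective aug)
  (ho : IsOpenMap aug) (Kv : Type) [Field Kv] [ValuativeRel Kv] (hp : ((p : Kv)) ∈ PadicFrd.intNonzero Kv)

/-- **[AbsAnab] Thm. 1.1.1 (ii), local half, at an ACTUAL place**: `G_v = Gal(F̄_v/F_v)` is slim, for every number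
field `F` and every finite place `v ∣ p` (`galoisMLF_slim_holds` at `F_v`, which is finite over `ℚ_p` by abc-iut-S7's
`[F_v : ℚ_p] = n_v`). ([IUTchI] Ex 3.3 (iii) p.79) [claim: Mochizuki2012, status: disputed] -/
theorem isSlimGroup_gal_ofPlace : IsSlimGroup (GaloisValDatum.ofPlace F p v hv).Gal :=
  haveI := GaloisValDatum.finiteDimensional_rescaledCompletion F p v hv
  galoisMLF_slim_holds p (RescaledCompletion F p v hv)

/-- **[IUTchI] Ex. 3.3 (iii) (b) UNCONDITIONAL at every actual good nonarchimedean place**: for `K_v := F_v` (`F` a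
number field, `v ∣ p` finite — the `K_v`, `v ∈ V̲^good ∩ V̲^non`, of Def. 3.1 (e)), `Ω := F̄_v`, and EVERY
`Π_v ↠ G_v`, the base `𝒟⊢_v = 𝓑(G_v)⁰` (resp. `𝒟^Θ_v`) is reconstructible from `𝒞⊢_v` (resp. `𝒞^Θ_v`) at
abc-iut-L5-t2's instance `ofGalois` — no hypothesis left. ([IUTchI] Ex 3.3 (iii) p.79) [claim: Mochizuki2012, status: disputed] -/
theorem basesFromC_ofGalois_ofPlace :
    (ofGalois (GaloisValDatum.ofPlace F p v hv) aug hc hs ho Kv hp).BasesFromC :=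
  basesFromC_ofGalois_of_isSlimGroup (GaloisValDatum.ofPlace F p v hv) aug hc hs ho Kv hp
    (isSlimGroup_gal_ofPlace F p v hv)

/-- **(b) hypothesis-free at the named witness `ofPlaceGalois F p v hv`** (abc-iut-L5-t2: `K_v := F_v`, `Ω := F̄_v`,
`Π_v := G_v`, carrier `F_v` with its norm relation). ([IUTchI] Ex 3.3 (iii) p.79) [claim: Mochizuki2012, status: disputed] -/
theorem basesFromC_ofPlaceGalois :
    @GoodLocalFrobenioid.BasesFromC p (RescaledCompletion F p v hv) _ (GaloisValDatum.normVal _)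
      (ofPlaceGalois F p v hv) := by
  letI := GaloisValDatum.normVal (RescaledCompletion F p v hv)
  exact basesFromC_ofGalois_of_isSlimGroup (GaloisValDatum.ofPlace F p v hv) _ _ _ _ _ _
    (isSlimGroup_gal_ofPlace F p v hv)

/-- **(c) hypothesis-free at the named witness `ofPlaceGalois F p v hv`** — there `Π_v := G_v` (labelled degenerate
choice: `𝒟_v = 𝒟⊢_v = 𝓑(G_v)⁰`), so slimness of `Π_v` IS [AbsAnab] Thm 1.1.1 (ii); for print's
`Π_v = π₁(X̲→_v)` use `dFromF_ofGalois_of_isSlimGroup` with [AbsAnab] Lem. 1.3.1 BY NAME.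
([IUTchI] Ex 3.3 (iii) p.79) [claim: Mochizuki2012, status: disputed] -/
theorem dFromF_ofPlaceGalois :
    @GoodLocalFrobenioid.DFromF p (RescaledCompletion F p v hv) _ (GaloisValDatum.normVal _)
      (ofPlaceGalois F p v hv) := by
  letI := GaloisValDatum.normVal (RescaledCompletion F p v hv)
  exact dFromF_ofGalois_of_isSlimGroup (GaloisValDatum.ofPlace F p v hv) _ _ _ _ _ _
    (isSlimGroup_gal_ofPlace F p v hv)

end Place

end GoodLocalFrobenioid

/-! ### At the initial Θ-datum's own local Frobenioids ([IUTchI] Def. 3.1 (e)(f), Ex. 3.3 (i)–(ii) for `D`) -/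

section Datum

open Literature.AnabelianGeometry.SemiGraphs

variable {F : Type u} {K : Type v} {Fbar : Type} [Field F] [NumberField F] [Field K] [NumberField K]
  [Algebra F K] [Field Fbar] [Algebra F Fbar] [Algebra K Fbar] [IsScalarTower F K Fbar] [Normal K Fbar]
  {E : WeierstrassCurve F} [E.IsElliptic] {l : ℕ} {Pb : BadPlacePredicates K}
  (D : InitialThetaData F K Fbar E l Pb) (p : ℕ) [Fact p.Prime]
  (k : Type) [NontriviallyNormedField k] [CompleteSpace k] [IsUltrametricDist k] [NormedAlgebra ℚ_[p] k]
  [FiniteDimensional ℚ_[p] k] [Algebra K k]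

namespace InitialThetaData

/-- **[IUTchI] Ex. 3.3 (iii) (b) for the initial Θ-datum `D` at `v̲ ∈ V̲^good ∩ V̲^non`, `K_v̲ = k`, along a
`K`-embedding `ι : F̄ → k̄` — UNCONDITIONAL** (only the datum's printed openness input `hX` of Def. 3.1 (f) enters, as
for the object itself): `𝒟⊢_v̲ = 𝓑(G_v̲)⁰` (resp. `𝒟^Θ_v̲`) is reconstructible from `𝒞⊢_v̲` (resp. `𝒞^Θ_v̲`), where
`𝒟_v̲ = 𝓑(Π_{X̲→_v̲})⁰` is built from `D` (abc-iut-L5-t2's `goodLocalFrobenioidOfEmb` = `ofGalois` at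
`GaloisValDatum.ofComplete p k` along `Π_v̲ ↠ G_v̲`, by `rfl`). ([IUTchI] Ex 3.3 (iii) p.79) [claim: Mochizuki2012, status: disputed] -/
theorem basesFromC_goodLocalFrobenioidOfEmb (ι : Fbar →ₐ[K] AlgebraicClosure k)
    (hX : IsOpen (D.PiXarrow : Set D.PiC)) :
    @GoodLocalFrobenioid.BasesFromC p k _ (GaloisValDatum.normVal k) (D.goodLocalFrobenioidOfEmb p k ι hX) := by
  letI := GaloisValDatum.normVal k
  exact GoodLocalFrobenioid.basesFromC_ofGalois_ofComplete p k _ _ _ _ k (GaloisValDatum.p_mem_normVal p k)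

/-- **[IUTchI] Ex. 3.3 (iii) (b) for `D` at `v̲ ∈ V̲^good ∩ V̲^non`, `K_v̲ = k`, chosen embedding — UNCONDITIONAL.**
([IUTchI] Ex 3.3 (iii) p.79) [claim: Mochizuki2012, status: disputed] -/
theorem basesFromC_goodLocalFrobenioid (hX : IsOpen (D.PiXarrow : Set D.PiC)) :
    @GoodLocalFrobenioid.BasesFromC p k _ (GaloisValDatum.normVal k) (D.goodLocalFrobenioid p k hX) :=
  D.basesFromC_goodLocalFrobenioidOfEmb p k _ hX

end InitialThetaData

end Datum

noncomputable section DatumPlace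

open Literature.AnabelianGeometry.SemiGraphs Literature.NumberTheory.NumberFields IsDedekindDomain NumberField

variable {F : Type u} {K : Type} {Fbar : Type} [Field F] [NumberField F] [Field K] [NumberField K]
  [Algebra F K] [Field Fbar] [Algebra F Fbar] [Algebra K Fbar] [IsScalarTower F K Fbar] [Normal K Fbar]
  {E : WeierstrassCurve F} [E.IsElliptic] {l : ℕ} {Pb : BadPlacePredicates K}
  (D : InitialThetaData F K Fbar E l Pb) (w : HeightOneSpectrum (𝓞 K)) (p : ℕ) [Fact p.Prime]
  (hw : ((p : ℕ) : 𝓞 K) ∈ w.asIdeal)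

namespace InitialThetaData

/-- **[IUTchI] Ex. 3.3 (iii) (b) for `D` AT THE ACTUAL PLACE `v̲ = w ∣ p` of `K`** (`K_v̲ := K_w` the completion,
`Ω := K̄_w`, `Π_v̲ := Π_{X̲→_K} ×_{G_K} G_w`): UNCONDITIONAL — `G_w` slim is [AbsAnab] Thm 1.1.1 (ii) as a tree theorem
at `K_w`. ([IUTchI] Ex 3.3 (iii) p.79) [claim: Mochizuki2012, status: disputed] -/
theorem basesFromC_goodLocalFrobenioidAt (hX : IsOpen (D.PiXarrow : Set D.PiC)) :
    @GoodLocalFrobenioid.BasesFromC p (RescaledCompletion K p w hw) _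
      (GaloisValDatum.normVal (RescaledCompletion K p w hw)) (D.goodLocalFrobenioidAt w p hw hX) := by
  letI : Algebra K (RescaledCompletion K p w hw) := inferInstanceAs (Algebra K (w.adicCompletion K))
  haveI := GaloisValDatum.finiteDimensional_rescaledCompletion K p w hw
  exact D.basesFromC_goodLocalFrobenioid p (RescaledCompletion K p w hw) hX

end InitialThetaData

end DatumPlace

end Literature.IUT.HodgeTheaters
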